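/-
Origin: expansion seat `prover-pub-hodgecm-mc-binder-2-g7-0`, handover #14 19:30Z md5 58392e469cd8 (129 l.; imports #13 + PKG `HodgeCM.PerL34.FockPrintLocalFock` (pv12) — all PRESENT in PKG RUN 35; INSTALL AFTER #13, DROP-ONLY-THIS-ROW on bounce; TORUS half of the dictionary: `circleScalarUnitary`, `torusLetter t = ((1,1),(t₁•1, t₂•1)) : DPK P' Q' R' S'`, entries `linSubst_star_dualPairι_torusLetter_X_PR` (`X_{(p,r)} ↦ C t₁ * X`) / `_X_PS` (`X_{(p,s)} ↦ C (conj t₂) * X`), **`linSubst_star_dualPairι_torusLetter_rename`**: `linSubst (star (dualPairι (torusLetter t))) (rename ι F) = rename ι (scalePi (circleUnits t) F)` and **`unitaryOpPi_dualPairι_torusLetter_binvPi`**: `unitaryOpPi (dualPairι (torusLetter t)) (binvPi (rename ι F)) = binvPi (rename ι (scalePi (circleUnits t) F))` — pv12's PRINTED torus scaling IS the Fock action of Konno–Konno's K_W-letter on printed vectors, so `omg_ins` reduces to the SCALAR identity `vac_b t = vacScalar e_b (torusLetter t) = t₁^{e_R(b)} t₂^{e_S(b)}` (VacReadOff); mirror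 `lean -o` rc 0 / 0 warn; `#print axioms` trio (`g7/certs/TorusDictionary_mirror.txt`)) (`HOME/mc/pub-hodgecm-mc-binder-2/g7/pkg/HodgeCM/Model/HypCensus/TorusDictionary.lean`, md5 58392e46, 129 lines);
landed by the gen-13 packager (p-g13) in gate run 37 as `HodgeCM/Model/HypCensus/TorusDictionary.lean` (verbatim).
-/
/-
Origin: speedrun cell pub-hodgecm, MODEL-CONSTRUCTION sub-cell, lineage mc-binder-2 (rows A12/A34 of the binder ledger:
`hyp12` / `hyp34`), seat prover-pub-hodgecm-mc-binder-2-g7-0 (gen 7), 2026-08-19.  Target in PKG: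
`HodgeCM/Model/HypCensus/TorusDictionary.lean` (NEW additive leaf; imports this lineage's `HypDictionary` (PKG `PerL34/ArchCHyperbolic` below
it) and PKG `PerL34/FockPrintLocalFock` (pv12); twin `SegalBargmann/FockDualPairCompact` via `JunctionSwapBargmann`).  KERNEL only.
-/
import Summits.HodgeConjecture.HodgeCM.Model.HypCensus.HypDictionary
import Summits.HodgeConjecture.HodgeCM.PerL34.FockPrintLocalFock

/-!
# Census kit (rows A12/A34), dictionary (torus half): pv12's PRINTED torus scaling IS the Fock action of Konno–Konno's `K_W`-letter

The census field `HypSmoothSide.omg_ins` asks that the printed torus `T_b = U(W_{1,b}) × U(W_{2,b})` act on the printed vectors by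
pv12's `LocalFock.ofPrintMCircle`: `ω t = vac_b t • scalePi (circleUnits t)`, `scalePi (t₁,t₂) : z_a ↦ t₁ z_a, w_a ↦ t₂⁻¹ w_a`
(PKG `PerL34/FockPrintKappaPart`, `FockPrintLocalFock`).  The kit's kernel file `TorusBlock` (#9) delivers the compact group's
action in Konno–Konno's block frame as `κOp e_b k = vacScalar e_b k • unitaryOpPi (dualPairι k)`, and the tree computes
`unitaryOpPi U (binvPi F) = binvPi (linSubst (star U) F)` (`SchwartzBargmannIntertwining.unitaryOpPi_binvPi`) with the block datum
`dualPairι ((a,b),(c,d)) = diag( conj(a⊗c), conj(b⊗d), a⊗d, b⊗c )` (`FockDualPairCompact.coe_dualPairι`).  This leaf proves that on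
printed vectors the two POLYNOMIAL actions AGREE: for the `W`-torus letter `k_t = ((1,1),(t₁·1, t₂·1))`,

* §1 `circleScalarUnitary t : unitaryGroup R ℂ` (`t • 1`), `torusLetter t : DPK P' Q' R' S'`;
* §2 the entries: `linSubst (star (dualPairι (torusLetter t))) (X (inl (inl (p, r)))) = C t₁ * X _` (same-sign block: conjugated
  twice) and `… (X (inr (inl (p, s)))) = C (conj t₂) * X _` (mixed block: conjugated once);
* §3 **`linSubst_star_dualPairι_torusLetter_rename`**: `linSubst (star (dualPairι (torusLetter t))) (rename ι F) = rename ι (scalePi (circleUnits t) F)`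
  for every printed polynomial `F` (`conj t₂ = t₂⁻¹` on `U(1)`), and hence **`unitaryOpPi_dualPairι_torusLetter_binvPi`**:
  `unitaryOpPi (dualPairι (torusLetter t)) (binvPi (rename ι F)) = binvPi (rename ι (scalePi (circleUnits t) F))`.

Consequence for `omg_ins`: with #9/#12, `ω′(s(κ k_t)) (ins φ) = vacScalar e_b k_t • ins (scalePi t φ)`, so the printed clause holds iff
the SCALARS agree, `vac_b t = vacScalar e_b k_t = t₁^{e_R(b)} t₂^{e_S(b)}` — the exponent identities of `VacReadOff` (`pinnedVacs` exponents
`= (e_R(b), e_S(b))` up to the sign convention recorded there), exactly BINDER-TRIAGE §50.3 (W-val).  Nothing here is a claim of PerL/QW8.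
Style lint (L-notation): no `local notation`.
-/

set_option autoImplicit false

noncomputable section

open MvPolynomial Complex
open scoped BigOperators ComplexConjugate Kronecker
open Literature.Analysis.SegalBargmann
open Literature.RepresentationTheory.KonnoKonno2007 Literature.RepresentationTheory.KonnoKonno2007.RealDualPair
open HodgeCM.PerL34.Fock HodgeCM.PerL34.Fock.PrintDict

namespace HodgeCM.Model.HypCensus

section TorusDict

variable {P' R' S' : Type} [Fintype P'] [DecidableEq P'] [Fintype R'] [DecidableEq R'] [Fintype S'] [DecidableEq S']
variable (Q' : Type) [Fintype Q'] [DecidableEq Q'] (eA : Fin 3 ≃ P') (r₀ : R') (s₀ : S')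

/-! ## §1 The torus letter -/

/-- a unit complex number as the scalar unitary matrix `t • 1`. -/
def circleScalarUnitary (ι' : Type) [Fintype ι'] [DecidableEq ι'] (t : Circle) : Matrix.unitaryGroup ι' ℂ :=
  ⟨(t : ℂ) • (1 : Matrix ι' ι' ℂ), by
    rw [Matrix.mem_unitaryGroup_iff, star_smul, Matrix.star_eq_conjTranspose, Matrix.conjTranspose_one, smul_mul_smul_comm,
      mul_one, Complex.star_def, Complex.mul_conj, Circle.normSq_coe, Complex.ofReal_one, one_smul]⟩

/-- (Ported verbatim from the HodgeCMPerL package; no docstring in the source.) -/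
@[simp] theorem coe_circleScalarUnitary (ι' : Type) [Fintype ι'] [DecidableEq ι'] (t : Circle) :
    ((circleScalarUnitary ι' t : Matrix.unitaryGroup ι' ℂ) : Matrix ι' ι' ℂ) = (t : ℂ) • (1 : Matrix ι' ι' ℂ) := rfl

/-- **the `W`-torus letter** `k_t = ((1,1),(t₁·1, t₂·1)) ∈ K_V × K_W`. -/
def torusLetter (t : Circle × Circle) : DPK P' Q' R' S' :=
  ((1, 1), (circleScalarUnitary R' t.1, circleScalarUnitary S' t.2))

/-! ## §2 The substitution letter by letter -/

/-- same-sign block `P × R`: `X_{(p,r)} ↦ t₁ X_{(p,r)}` (the block datum conjugates `1 ⊗ t₁`, the substitution takes `star` again). -/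
theorem linSubst_star_dualPairι_torusLetter_X_PR (t : Circle × Circle) (p : P') (r : R') :
    linSubst (star ((dualPairι (torusLetter Q' t) : Matrix.unitaryGroup (DPIdx P' Q' R' S') ℂ) :
        Matrix (DPIdx P' Q' R' S') (DPIdx P' Q' R' S') ℂ)) (X (Sum.inl (Sum.inl (p, r)))) =
      C (t.1 : ℂ) * X (Sum.inl (Sum.inl (p, r))) := by
  rw [linSubst_X, torusLetter, coe_dualPairι]
  simp only [Fintype.sum_sum_type, Fintype.sum_prod_type, Matrix.star_apply, Matrix.fromBlocks_apply₁₁,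
    Matrix.fromBlocks_apply₂₁, Matrix.map_apply, Matrix.kroneckerMap_apply, star_star, Matrix.zero_apply,
    star_zero, coe_circleScalarUnitary, Matrix.smul_apply,
    Matrix.one_apply, smul_eq_mul, mul_ite, mul_one, mul_zero]
  simp only [OneMemClass.coe_one, Matrix.one_apply, ite_mul, one_mul, zero_mul, apply_ite C, map_zero,
    Finset.sum_ite_eq', Finset.mem_univ, if_true, Finset.sum_const_zero, add_zero]

/-- mixed block `P × S`: `X_{(p,s)} ↦ conj(t₂) X_{(p,s)}`. -/
theorem linSubst_star_dualPairι_torusLetter_X_PS (t : Circle × Circle) (p : P') (s : S') :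
    linSubst (star ((dualPairι (torusLetter Q' t) : Matrix.unitaryGroup (DPIdx P' Q' R' S') ℂ) :
        Matrix (DPIdx P' Q' R' S') (DPIdx P' Q' R' S') ℂ)) (X (Sum.inr (Sum.inl (p, s)))) =
      C (conj (t.2 : ℂ)) * X (Sum.inr (Sum.inl (p, s))) := by
  rw [linSubst_X, torusLetter, coe_dualPairι]
  simp only [Fintype.sum_sum_type, Fintype.sum_prod_type, Matrix.star_apply, Matrix.fromBlocks_apply₁₂,
    Matrix.fromBlocks_apply₂₂, Matrix.fromBlocks_apply₁₁, Matrix.fromBlocks_apply₂₁, Matrix.kroneckerMap_apply,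
    Matrix.zero_apply, star_zero, coe_circleScalarUnitary,
    Matrix.smul_apply, Matrix.one_apply, smul_eq_mul, mul_ite, mul_one, mul_zero]
  simp only [OneMemClass.coe_one, Matrix.one_apply, ite_mul, one_mul, zero_mul, apply_ite C, apply_ite star, star_zero,
    map_zero, Finset.sum_ite_eq', Finset.mem_univ, if_true, Finset.sum_const_zero, zero_add, add_zero, star_def]

/-! ## §3 The printed scaling IS the substitution by the torus letter -/

/-- **TORUS DICTIONARY (polynomial level)**: `linSubst (star (dualPairι k_t)) (rename ι F) = rename ι (scalePi (circleUnits t) F)`.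
[Folland1989, Prop. (4.39); Ad07 via pv12 `scalePi`] -/
theorem linSubst_star_dualPairι_torusLetter_rename (t : Circle × Circle) (F : HodgeCM.PerL34.Fock.MixedModel) :
    linSubst (star ((dualPairι (torusLetter Q' t) : Matrix.unitaryGroup (DPIdx P' Q' R' S') ℂ) :
        Matrix (DPIdx P' Q' R' S') (DPIdx P' Q' R' S') ℂ)) (rename (mixedToDPIdx Q' eA r₀ s₀) F) =
      rename (mixedToDPIdx Q' eA r₀ s₀) (scalePi (circleUnits t) F) := by
  -- both sides are algebra homomorphisms of `F`; compare on the variables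
  suffices h : (linSubst (star ((dualPairι (torusLetter Q' t) : Matrix.unitaryGroup (DPIdx P' Q' R' S') ℂ) :
        Matrix (DPIdx P' Q' R' S') (DPIdx P' Q' R' S') ℂ))).comp (rename (mixedToDPIdx Q' eA r₀ s₀)) =
      (rename (mixedToDPIdx Q' eA r₀ s₀)).comp (scalePi (circleUnits t)) from
    AlgHom.congr_fun h F
  refine MvPolynomial.algHom_ext fun v => ?_
  rcases v with a | a
  · rw [AlgHom.comp_apply, AlgHom.comp_apply, rename_X, mixedToDPIdx_inl, linSubst_star_dualPairι_torusLetter_X_PR,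
      scalePi_X, scaleWt_inl, map_smul, rename_X, mixedToDPIdx_inl, circleUnits_fst_coe, smul_eq_C_mul]
  · rw [AlgHom.comp_apply, AlgHom.comp_apply, rename_X, mixedToDPIdx_inr, linSubst_star_dualPairι_torusLetter_X_PS,
      scalePi_X, scaleWt_inr, map_smul, rename_X, mixedToDPIdx_inr, smul_eq_C_mul]
    congr 2
    rw [← Circle.coe_inv_eq_conj]
    rfl

/-- **TORUS DICTIONARY (Schwartz level)**: `unitaryOpPi (dualPairι k_t) (binvPi (rename ι F)) = binvPi (rename ι (scalePi t F))`.
[Folland1989, Prop. (4.39)] -/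
theorem unitaryOpPi_dualPairι_torusLetter_binvPi (t : Circle × Circle) (F : HodgeCM.PerL34.Fock.MixedModel) :
    unitaryOpPi (dualPairι (torusLetter Q' t) : Matrix.unitaryGroup (DPIdx P' Q' R' S') ℂ)
        (binvPi (rename (mixedToDPIdx Q' eA r₀ s₀) F)) =
      binvPi (rename (mixedToDPIdx Q' eA r₀ s₀) (scalePi (circleUnits t) F)) := by
  rw [unitaryOpPi_binvPi, linSubst_star_dualPairι_torusLetter_rename]

end TorusDict

end HodgeCM.Model.HypCensus

end
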